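import Summits.QuantumFields.QCD.Theses.HeatSlicedQuarks
import Literature.MathematicalPhysics.QuantumLattice.OverlapLocality
import Literature.MathematicalPhysics.QuantumLattice.LatticeToriProofs
import Literature.MathematicalPhysics.QuantumLattice.LinkHopCommutators
import Literature.Analysis.Matrix.QuadraticCombesThomas

/-!
# Stub `stub_highBlockLocality` of line `low-mode-quarantine`
(crux `Summit.QuantumFields.QCD.Theses.HeatSlicedQuarks.RobustYangMillsHandover`,
item stmt-QuantumFields-8892)

**The coercive block is quasi-local uniformly in the gauge field.**  There are universal
constants `C, c > 0` (here `C = 2`, `c = 1/384`) such that on every periodic lattice `(ℤ/L)⁴`,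
for EVERY `SU(3)` gauge field `U`, every mass `m ∈ [−1, 1]` and every `λ ∈ (0, 1]`, the
resolvent of `H = D_Wᴴ D_W` (`D_W = wilsonDirac (fundamentalRep (Fin 3)) U m 1`, the `r = 1`
Wilson–Dirac operator) at spectral scale `λ` obeys
`|(D_Wᴴ D_W + λ)⁻¹((x,a,α),(y,b,β))| ≤ (C/λ) exp(−c √λ · torusDist x y)`.

Proof: the QUADRATIC Combes–Thomas bound
`Literature.Analysis.Matrix.quadratic_combes_thomas` (conjugation of `D` by `e^{θ dist(·,y)}`,
Schur test for the perturbations `E_±`, accretivity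
`Re⟨v, ((D+E₋)ᴴ(D+E₊) + λ)v⟩ ≥ (λ − 2η‖·‖…)`) applied on the index set
`TorusSite 4 L × Fin 3 × Fin 4` with the site metric `torusDist`, `A = D_W`, floor `F = 0`,
`μ = λ`, `γ = λ/2` and rate `θ = √λ/384`.  The only input about `D_W` is geometric and uniform in
`U` and `m`: it has RANGE ONE (`hbl_wilsonDirac_range`: a nonzero entry joins equal or
nearest-neighbour sites) and its off-site absolute row and column sums are at most `h = 96`
(`hbl_wilsonDirac_rowSum_le`, `hbl_wilsonDirac_colSum_le`: at most one forward and one backward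
hop per direction, each entry of modulus `≤ ½ · |(1 ∓ γ_μ)_{αβ}| · |ρ(U)_{ab}| ≤ ½ · 2 · 1`,
summed over `4` directions and the `12` colour–spin indices of the neighbour).  With
`θ = √λ/384 ≤ 1` one has `η = 96(e^θ − 1) ≤ 192 θ = √λ/2` (`Real.abs_exp_sub_one_le`), hence
`t² − 2ηt − η² + λ ≥ (t − √λ/2)² + λ/2 ≥ λ/2` for all `t ≥ 0`, and the abstract bound gives
`(2/λ) e^{−θ·torusDist x y}`.  No spectral information on `U` is used.  Valid on every torus
`L ≥ 1` (for `L ≤ 2` forward and backward hops may coincide or be on-site; only absolute values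
are summed, and on-site entries are not in the off-site sums).

References: Combes–Thomas, Comm. Math. Phys. 34 (1973) 251 [CombesThomas1973];
Aizenman–Warzel, GSM 168, §10.3 [AizenmanWarzel2015].
-/

namespace Summit.QuantumFields.QCD.Cruxes.RobustYangMillsHandover.LowModeQuarantine

open scoped BigOperators Classical Matrix
open Literature.MathematicalPhysics.QuantumFieldTheory
open Literature.MathematicalPhysics.QuantumLattice
open Literature.Probability.LatticeModels (TorusSite)
open Filter Topology

/-- Entries of the Euclidean gamma matrices have modulus `≤ 1` (`γ_μ` is unitary:
`γ_μᴴ γ_μ = γ_μ² = 1`). -/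
private theorem hbl_norm_euclideanGamma_apply_le (μ : Fin 4) (α β : Fin 4) :
    ‖euclideanGamma μ α β‖ ≤ 1 := by
  refine entry_norm_bound_of_unitary (Matrix.mem_unitaryGroup_iff'.mpr ?_) α β
  rw [Matrix.star_eq_conjTranspose, (euclideanGamma_isHermitian μ).eq, euclideanGamma_mul_self]

/-- Entries of `r·1 ∓ γ_μ` at `r = 1` have modulus `≤ 2`. -/
private theorem hbl_norm_one_sub_gamma_apply_le (μ : Fin 4) (α β : Fin 4) :
    ‖(((1 : ℝ) : ℂ) • (1 : Matrix (Fin 4) (Fin 4) ℂ) - euclideanGamma μ) α β‖ ≤ 2 ∧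
      ‖(((1 : ℝ) : ℂ) • (1 : Matrix (Fin 4) (Fin 4) ℂ) + euclideanGamma μ) α β‖ ≤ 2 := by
  have h1 : ‖(1 : Matrix (Fin 4) (Fin 4) ℂ) α β‖ ≤ 1 := by
    rw [Matrix.one_apply]; split_ifs <;> simp
  have h2 := hbl_norm_euclideanGamma_apply_le μ α β
  simp only [Complex.ofReal_one, one_smul, Matrix.sub_apply, Matrix.add_apply]
  exact ⟨(norm_sub_le _ _).trans (by linarith), (norm_add_le _ _).trans (by linarith)⟩

variable {L : ℕ} [NeZero L]

omit [NeZero L] in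
/-- Off the diagonal, an entry of the Wilson–Dirac matrix is a sum of at most one forward and one
backward hop per direction, each of modulus `≤ ½ · 2 · 1`:
`|D_{pq}| ≤ Σ_μ (𝟙[q = p + μ̂] + 𝟙[p = q + μ̂])` (site components). -/
private theorem hbl_norm_wilsonDirac_apply_le
    (U : GaugeConfig 4 L ↥(Matrix.specialUnitaryGroup (Fin 3) ℂ)) (m : ℝ)
    {p q : TorusSite 4 L × Fin 3 × Fin 4} (hpq : p ≠ q) :
    ‖wilsonDirac (fundamentalRep (Fin 3)) U m 1 p q‖ ≤
      ∑ μ : Fin 4, ((if q.1 = Site.shift p.1 μ then (1 : ℝ) else 0) +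
        (if p.1 = Site.shift q.1 μ then (1 : ℝ) else 0)) := by
  have hU : ∀ g : ↥(Matrix.specialUnitaryGroup (Fin 3) ℂ), ∀ a b : Fin 3,
      ‖fundamentalRep (Fin 3) g a b‖ ≤ 1 := fun g a b =>
    entry_norm_bound_of_unitary (fundamentalRep_mem_unitaryGroup g) a b
  simp only [wilsonDirac, Matrix.of_apply, if_neg hpq, zero_sub, norm_neg, norm_mul]
  have hhalf : ‖(1 / 2 : ℂ)‖ = 1 / 2 := by norm_num
  rw [hhalf]
  have hterm : ∀ μ : Fin 4,
      ‖(if q.1 = Site.shift p.1 μ then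
            (((1 : ℝ) : ℂ) • (1 : Matrix (Fin 4) (Fin 4) ℂ) - euclideanGamma μ) p.2.2 q.2.2 *
              fundamentalRep (Fin 3) (U (p.1, μ)) p.2.1 q.2.1 else 0) +
          (if p.1 = Site.shift q.1 μ then
            (((1 : ℝ) : ℂ) • (1 : Matrix (Fin 4) (Fin 4) ℂ) + euclideanGamma μ) p.2.2 q.2.2 *
              fundamentalRep (Fin 3) (U (q.1, μ))⁻¹ p.2.1 q.2.1 else 0)‖ ≤
        2 * ((if q.1 = Site.shift p.1 μ then (1 : ℝ) else 0) +
          (if p.1 = Site.shift q.1 μ then (1 : ℝ) else 0)) := by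
    intro μ
    obtain ⟨hm, hp⟩ := hbl_norm_one_sub_gamma_apply_le μ p.2.2 q.2.2
    refine (norm_add_le _ _).trans ?_
    rw [mul_add]
    refine add_le_add ?_ ?_
    · split_ifs with hc
      · rw [norm_mul]
        calc _ ≤ 2 * 1 := mul_le_mul hm (hU _ _ _) (norm_nonneg _) zero_le_two
          _ = 2 * 1 := rfl
      · simp
    · split_ifs with hc
      · rw [norm_mul]
        calc _ ≤ 2 * 1 := mul_le_mul hp (hU _ _ _) (norm_nonneg _) zero_le_two
          _ = 2 * 1 := rfl
      · simp
  calc 1 / 2 * ‖∑ μ : Fin 4, _‖ ≤ 1 / 2 * ∑ μ : Fin 4,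
        2 * ((if q.1 = Site.shift p.1 μ then (1 : ℝ) else 0) +
          (if p.1 = Site.shift q.1 μ then (1 : ℝ) else 0)) := by
        refine mul_le_mul_of_nonneg_left
          ((norm_sum_le _ _).trans (Finset.sum_le_sum fun μ _ => hterm μ)) ?_
        norm_num
    _ = _ := by rw [← Finset.mul_sum]; ring

/-- **Range one**: `D_{pq} ≠ 0` forces `torusDist p q ≤ 1` (site components). -/
private theorem hbl_wilsonDirac_range
    (U : GaugeConfig 4 L ↥(Matrix.specialUnitaryGroup (Fin 3) ℂ)) (m : ℝ)
    (p q : TorusSite 4 L × Fin 3 × Fin 4)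
    (h : wilsonDirac (fundamentalRep (Fin 3)) U m 1 p q ≠ 0) : torusDist p.1 q.1 ≤ 1 := by
  by_contra hd
  rw [not_le] at hd
  have hpq : p ≠ q := by
    rintro rfl
    rw [torusDist_self] at hd
    exact Nat.not_succ_le_zero 1 hd
  have h1 : ∀ μ : Fin 4, ¬ q.1 = Site.shift p.1 μ := by
    intro μ hq
    have := torusDist_add_single_le_one p.1 μ
    rw [torusDist_comm', ← Site.shift, ← hq] at this
    -- this : torusDist p.1 q.1 ≤ 1
    omega
  have h2 : ∀ μ : Fin 4, ¬ p.1 = Site.shift q.1 μ := by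
    intro μ hp
    have := torusDist_add_single_le_one q.1 μ
    rw [← Site.shift, ← hp] at this
    omega
  have hle := hbl_norm_wilsonDirac_apply_le U m hpq
  simp only [if_neg (h1 _), if_neg (h2 _), add_zero, Finset.sum_const_zero] at hle
  exact h (norm_le_zero_iff.mp hle)

/-- Counting: `#{(y, b, β) | y = s} = 12`. -/
private theorem hbl_sum_ite_fst_eq (s : TorusSite 4 L) :
    ∑ q : TorusSite 4 L × Fin 3 × Fin 4, (if q.1 = s then (1 : ℝ) else 0) = 12 := by
  rw [Fintype.sum_prod_type, Finset.sum_eq_single s (fun y _ hy => by simp [hy]) (by simp)]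
  simp only [if_true, Finset.sum_const, Finset.card_univ, Fintype.card_prod, Fintype.card_fin,
    nsmul_eq_mul, mul_one]
  norm_num

/-- **Row sums**: `Σ_{q : dist(p,q) ≠ 0} |D_{pq}| ≤ 96`. -/
private theorem hbl_wilsonDirac_rowSum_le
    (U : GaugeConfig 4 L ↥(Matrix.specialUnitaryGroup (Fin 3) ℂ)) (m : ℝ)
    (p : TorusSite 4 L × Fin 3 × Fin 4) :
    ∑ q ∈ Finset.univ.filter (fun q : TorusSite 4 L × Fin 3 × Fin 4 => torusDist p.1 q.1 ≠ 0),
      ‖wilsonDirac (fundamentalRep (Fin 3)) U m 1 p q‖ ≤ 96 := by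
  calc _ ≤ ∑ q ∈ Finset.univ.filter
          (fun q : TorusSite 4 L × Fin 3 × Fin 4 => torusDist p.1 q.1 ≠ 0),
        ∑ μ : Fin 4, ((if q.1 = Site.shift p.1 μ then (1 : ℝ) else 0) +
          (if p.1 = Site.shift q.1 μ then (1 : ℝ) else 0)) := by
        refine Finset.sum_le_sum fun q hq => hbl_norm_wilsonDirac_apply_le U m ?_
        rintro rfl
        rw [Finset.mem_filter, torusDist_self] at hq
        exact hq.2 rfl
    _ ≤ ∑ q : TorusSite 4 L × Fin 3 × Fin 4,
        ∑ μ : Fin 4, ((if q.1 = Site.shift p.1 μ then (1 : ℝ) else 0) +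
          (if p.1 = Site.shift q.1 μ then (1 : ℝ) else 0)) :=
        Finset.sum_le_univ_sum_of_nonneg fun q => Finset.sum_nonneg fun μ _ => by positivity
    _ = ∑ μ : Fin 4, ((12 : ℝ) + 12) := by
        rw [Finset.sum_comm]
        refine Finset.sum_congr rfl fun μ _ => ?_
        rw [Finset.sum_add_distrib, hbl_sum_ite_fst_eq]
        simp_rw [eq_shift_iff p.1 _ μ]
        rw [hbl_sum_ite_fst_eq]
    _ = 96 := by norm_num

/-- **Column sums**: `Σ_{p : dist(p,q) ≠ 0} |D_{pq}| ≤ 96`. -/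
private theorem hbl_wilsonDirac_colSum_le
    (U : GaugeConfig 4 L ↥(Matrix.specialUnitaryGroup (Fin 3) ℂ)) (m : ℝ)
    (q : TorusSite 4 L × Fin 3 × Fin 4) :
    ∑ p ∈ Finset.univ.filter (fun p : TorusSite 4 L × Fin 3 × Fin 4 => torusDist p.1 q.1 ≠ 0),
      ‖wilsonDirac (fundamentalRep (Fin 3)) U m 1 p q‖ ≤ 96 := by
  calc _ ≤ ∑ p ∈ Finset.univ.filter
          (fun p : TorusSite 4 L × Fin 3 × Fin 4 => torusDist p.1 q.1 ≠ 0),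
        ∑ μ : Fin 4, ((if q.1 = Site.shift p.1 μ then (1 : ℝ) else 0) +
          (if p.1 = Site.shift q.1 μ then (1 : ℝ) else 0)) := by
        refine Finset.sum_le_sum fun p hp => hbl_norm_wilsonDirac_apply_le U m ?_
        rintro rfl
        rw [Finset.mem_filter, torusDist_self] at hp
        exact hp.2 rfl
    _ ≤ ∑ p : TorusSite 4 L × Fin 3 × Fin 4,
        ∑ μ : Fin 4, ((if q.1 = Site.shift p.1 μ then (1 : ℝ) else 0) +
          (if p.1 = Site.shift q.1 μ then (1 : ℝ) else 0)) :=
        Finset.sum_le_univ_sum_of_nonneg fun p => Finset.sum_nonneg fun μ _ => by positivity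
    _ = ∑ μ : Fin 4, ((12 : ℝ) + 12) := by
        rw [Finset.sum_comm]
        refine Finset.sum_congr rfl fun μ _ => ?_
        rw [Finset.sum_add_distrib, hbl_sum_ite_fst_eq]
        simp_rw [eq_shift_iff q.1 _ μ]
        rw [hbl_sum_ite_fst_eq]
    _ = 96 := by norm_num


/-- **stub_highBlockLocality — the coercive block is quasi-local uniformly in the field**
(registered stub of line `low-mode-quarantine`): with `C = 2` and `c = 1/384`, for every `L`,
every `SU(3)` field `U`, every `m ∈ [−1, 1]`, every `λ ∈ (0, 1]` and all indices,
`|(D_Wᴴ D_W + λ)⁻¹((x,a,α),(y,b,β))| ≤ (C/λ) exp(−c √λ · torusDist x y)`.  Quadratic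
Combes–Thomas (`Literature.Analysis.Matrix.quadratic_combes_thomas`) with `F = 0`, `μ = λ`,
`γ = λ/2`, `θ = √λ/384`, `h = 96`. -/
theorem stub_highBlockLocality :
    ∃ C c : ℝ, 0 < c ∧
      ∀ (L : ℕ) [NeZero L] (U : GaugeConfig 4 L (Matrix.specialUnitaryGroup (Fin 3) ℂ)) (m : ℝ),
        m ∈ Set.Icc (-1 : ℝ) 1 → ∀ lam : ℝ, 0 < lam → lam ≤ 1 →
          ∀ (x y : TorusSite 4 L) (a b : Fin 3) (α β : Fin 4),
            ‖((wilsonDirac (fundamentalRep (Fin 3)) U m 1)ᴴ * wilsonDirac (fundamentalRep (Fin 3)) U m 1 +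
                (lam : ℂ) • (1 : Matrix (TorusSite 4 L × Fin 3 × Fin 4) (TorusSite 4 L × Fin 3 × Fin 4) ℂ))⁻¹
                (x, a, α) (y, b, β)‖ ≤
              C / lam * Real.exp (-(c * Real.sqrt lam * torusDist x y)) := by
  refine ⟨2, 1 / 384, by norm_num, ?_⟩
  intro L _ U m _ lam hlam hlam1 x y a b α β
  -- the Combes–Thomas rate `θ = √λ / 384`, so that `η = 96 (e^θ − 1) ≤ √λ / 2`
  set θ : ℝ := 1 / 384 * Real.sqrt lam with hθ
  have hθ0 : 0 ≤ θ := by positivity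
  have hsq1 : Real.sqrt lam ≤ 1 := Real.sqrt_le_one.mpr hlam1
  have hθ1 : |θ| ≤ 1 := by rw [abs_of_nonneg hθ0, hθ]; linarith
  have hη : 96 * (Real.exp θ - 1) ≤ Real.sqrt lam / 2 := by
    have h1 := Real.abs_exp_sub_one_le hθ1
    rw [abs_of_nonneg hθ0, abs_of_nonneg (by linarith [Real.add_one_le_exp θ])] at h1
    rw [hθ] at h1
    linarith
  have hη0 : 0 ≤ 96 * (Real.exp θ - 1) := by nlinarith [Real.add_one_le_exp θ]
  -- coercivity margin: `t² − 2ηt − η² + λ ≥ (t − √λ/2)² + λ/2 ≥ λ/2` for `t ≥ 0`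
  have hcoer : ∀ t : ℝ, Real.sqrt 0 ≤ t → lam / 2 ≤
      t ^ 2 - 2 * (96 * (Real.exp θ - 1)) * t - (96 * (Real.exp θ - 1)) ^ 2 + lam := by
    intro t ht
    rw [Real.sqrt_zero] at ht
    have hlam2 : Real.sqrt lam ^ 2 = lam := Real.sq_sqrt hlam.le
    have h1 : 2 * (96 * (Real.exp θ - 1)) * t ≤ Real.sqrt lam * t := by nlinarith
    have h2 : (96 * (Real.exp θ - 1)) ^ 2 ≤ lam / 4 := by nlinarith
    nlinarith [sq_nonneg (t - Real.sqrt lam / 2)]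
  -- the abstract quadratic Combes–Thomas bound on `TorusSite 4 L × Fin 3 × Fin 4`
  obtain ⟨-, hB⟩ := Literature.Analysis.Matrix.quadratic_combes_thomas
    (fun p q : TorusSite 4 L × Fin 3 × Fin 4 => torusDist p.1 q.1) (fun p => torusDist_self p.1)
    (fun p q => torusDist_comm' p.1 q.1) (fun p q r => torusDist_triangle' p.1 q.1 r.1)
    (wilsonDirac (fundamentalRep (Fin 3)) U m 1) (fun p q h => hbl_wilsonDirac_range U m p q h) 96
    (hbl_wilsonDirac_rowSum_le U m) (hbl_wilsonDirac_colSum_le U m) 0 lam θ (lam / 2) hθ0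
    (by positivity) (fun v => by rw [zero_mul]; exact Finset.sum_nonneg fun i _ => by positivity)
    hcoer
  have h := hB (x, a, α) (y, b, β)
  have h2 : 1 / (lam / 2) = 2 / lam := by field_simp
  rw [h2] at h
  exact h

end Summit.QuantumFields.QCD.Cruxes.RobustYangMillsHandover.LowModeQuarantine
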